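import Summits.SmoothPoincare4.SmoothPoincare4.Theorems.CylinderEntropyCylinderRungTwoRelaxationOfAreaToFloor
import Summits.SmoothPoincare4.SmoothPoincare4.Theorems.CylinderEntropyCylinderRungTwoHamiltonMonotonicity
import HarnessLib

/-!
# Route `CylinderEntropy`, crux `CylinderRungTwo` (stmt-SmoothPoincare4-7631), line `killing-flux`:
# upper Gaussian density bound at ALL scales and all centres for large times
# (registered helper `helper_upperDensityAllScales`; lead c4, "relaxation up to multiplicity",
# worker R7)

Along a smooth mean curvature flow `IsCylinderMCF M F ν T` of closed embedded cross-sections of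
`N = S⁴ × ℝ ⊂ ℝ⁶` whose time slices `M_t = range (F t)` separate the ends of `N`, write
`vol = μH⁴(S⁴)`, `A(t) = μH⁴(M_t)` and `A_∞ = ⨅_{t ≥ T} A(t)`.  Then for every `ε > 0` there is a
time `s₀ ≥ T` such that for all `s ≥ s₀`, every centre `p ∈ N` and EVERY scale `τ > 0` the typed
slice-normalised Gaussian density satisfies

  `F̂_{p,τ}(M_s) ≤ (1 + ε) · A_∞ / vol`.

Proof (the ε-bookkeeping of `stub_relaxationOfAreaToFloor`, with the area floor replaced by the
infimum of the areas).  (1) Every separating slice has `vol ≤ A(t)` (tree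
`hausdorffMeasure_sphere_le_of_separatesEnds`), so `0 < vol ≤ A_∞ ≤ A(T) < ∞`.  (2) Put
`δ = min(ε,1)/3`; since `A_∞ < (1+δ) A_∞` there is a time `t₁ ≥ T` with `A(t₁) < (1+δ) A_∞`
(`iInf_lt_iff`), and a lag `σ₀ ≥ 1` with geometric kernel tail `t(σ₀) < δ` (`tendsto_tail_atTop`).
(3) For `s ≥ s₀ = t₁ + σ₀`, Hamilton's monotonicity (`IsCylinderMCF.cylDensity_le`, landed) with
base time `t₁` and lag `s - t₁` moves `F̂_{p,τ}(M_s)` to `F̂_{p,τ+s-t₁}(M_{t₁})`, a density at scale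
`≥ σ₀ ≥ 1`, which the soft large-scale kernel bound `cylDensity_le_one_add_tail_mul` estimates by
`(1 + t(τ+s-t₁)) A(t₁)/vol ≤ (1+δ)² A_∞/vol ≤ (1+ε) A_∞/vol`.

Everything here is PROVED (no `sorry`, no definitions, no named facts).

References: R. S. Hamilton, *Monotonicity formulas for parabolic flows on manifolds*, Comm. Anal.
Geom. 1 (1993) 127–137, Thm. 4.1 (the monotone quantity); the kernel tail bound is elementary.
-/

-- the prescribed namespace `Summit.SmoothPoincare4.SmoothPoincare4.…` repeats `SmoothPoincare4`
set_option linter.dupNamespace false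

noncomputable section

open Bundle Set Function Filter MeasureTheory Module
open scoped Manifold ContDiff Topology RealInnerProductSpace BigOperators ENNReal NNReal

namespace Summit.SmoothPoincare4.SmoothPoincare4.Cruxes.CylinderRungTwo.KillingFlux

open Literature.Geometry.Riemannian Literature.Geometry.Riemannian.EuclideanHypersurface
open Literature.Geometry.Lorentzian Literature.Geometry.Lorentzian.PseudoRiemannianMetric
open Literature.Geometry.Riemannian.SphericalCylinderEntropy

/-- **Registered helper `helper_upperDensityAllScales` (R7): upper Gaussian density bound at ALL
scales and all centres for large times.** Along a smooth mean curvature flow `IsCylinderMCF M F ν T`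
of closed embedded cross-sections of `N = S⁴ × ℝ` with separating slices, for every `ε > 0` there is
`s₀ ≥ T` with `F̂_{p,τ}(M_s) ≤ (1+ε) · (⨅_{t ≥ T} μH⁴(M_t)) / μH⁴(S⁴)` for all `s ≥ s₀`, `p ∈ N`,
`τ > 0`: Hamilton's monotonicity with a large lag plus the large-scale kernel tail bound, at a base
time whose area is within `1 + δ` of the infimum of the areas. [cite: Hamilton1993, §4] -/
theorem helper_upperDensityAllScales : ∀ (M : Type) [TopologicalSpace M] [T2Space M] [SecondCountableTopology M] [ChartedSpace (EuclideanSpace ℝ (Fin 4)) M] [IsManifold (𝓡 4) ∞ M] [CompactSpace M] [MeasurableSpace M] [BorelSpace M] (F : ℝ → M → EuclideanSpace ℝ (Fin 6)) (ν : ℝ → M → EuclideanSpace ℝ (Fin 6)) (T : ℝ), IsCylinderMCF M F ν T → (∀ t, T ≤ t → SeparatesEnds (Set.range (F t))) → ∀ ε : ℝ, 0 < ε → ∃ s₀ : ℝ, T ≤ s₀ ∧ ∀ s, s₀ ≤ s → ∀ p : EuclideanSpace ℝ (Fin 6), ∑ i : Fin 5, p (Fin.castSucc i) ^ 2 = 1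 → ∀ τ : ℝ, 0 < τ → Literature.Geometry.Riemannian.SphericalCylinderEntropy.cylDensity (Set.range (F s)) p τ ≤ ENNReal.ofReal (1 + ε) * ((μH[4] (Metric.sphere (0 : EuclideanSpace ℝ (Fin 5)) 1))⁻¹ * ⨅ t : Set.Ici T, μH[4] (Set.range (F t))) := by
  intro M _ _ _ _ _ _ _ _ F ν T hF hsep ε hε
  -- the slack
  set δ : ℝ := min ε 1 / 3 with hδ
  have hδpos : 0 < δ := by rw [hδ]; exact div_pos (lt_min hε one_pos) (by norm_num)
  have hδ3 : δ ≤ 1 / 3 := by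
    rw [hδ]; exact div_le_div_of_nonneg_right (min_le_right ε 1) (by norm_num)
  have hδε : 3 * δ ≤ ε := by
    rw [hδ]; linarith [min_le_left ε 1]
  -- the infimum of the areas is neither `0` (area floor of separating slices) nor `⊤`
  set Ainf : ℝ≥0∞ := ⨅ t : Set.Ici T, μH[4] (Set.range (F t)) with hAinf
  have hvol0 : μH[4] (Metric.sphere (0 : (EuclideanSpace ℝ (Fin 5))) 1) ≠ 0 :=
    hausdorffMeasure_sphere_four_pos.ne'
  have hfloor : μH[4] (Metric.sphere (0 : (EuclideanSpace ℝ (Fin 5))) 1) ≤ Ainf := by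
    refine le_iInf fun t => ?_
    obtain ⟨R, hR⟩ := hsep t t.2
    exact hausdorffMeasure_sphere_le_of_separatesEnds hR
  have hA0 : Ainf ≠ 0 := fun h => hvol0 (le_zero_iff.1 (h ▸ hfloor))
  have hAtop : Ainf ≠ ⊤ := by
    refine ne_top_of_le_ne_top ?_
      (iInf_le (fun t : Set.Ici T => μH[4] (Set.range (F t))) ⟨T, Set.self_mem_Ici⟩)
    exact (hausdorffMeasure_range_lt_top_of_isSpacelikeImmersion
      (hF.isSpacelikeImmersion T le_rfl) (hF.injective le_rfl)).ne
  -- a time where the area is within `1+δ` of the infimum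
  obtain ⟨t₁, hTt₁, harea⟩ : ∃ t₁ : ℝ, T ≤ t₁ ∧
      μH[4] (Set.range (F t₁)) < ENNReal.ofReal (1 + δ) * Ainf := by
    have hlt : Ainf < ENNReal.ofReal (1 + δ) * Ainf := by
      conv_lhs => rw [← one_mul Ainf]
      exact ENNReal.mul_lt_mul_left hA0 hAtop (ENNReal.one_lt_ofReal.2 (by linarith))
    rw [hAinf] at hlt
    obtain ⟨⟨t₁, ht₁⟩, h⟩ := iInf_lt_iff.1 hlt
    exact ⟨t₁, ht₁, h⟩
  -- a lag beyond which the kernel tail is below `δ`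
  obtain ⟨σ₀, hσ₀1, hσ₀⟩ : ∃ σ₀ : ℝ, 1 ≤ σ₀ ∧ tail σ₀ < δ :=
    ((Filter.eventually_ge_atTop 1).and
      ((tendsto_order.1 tendsto_tail_atTop).2 δ hδpos)).exists
  refine ⟨t₁ + σ₀, by linarith, fun s hs p hp τ hτ => ?_⟩
  have hσ : 0 ≤ s - t₁ := by linarith
  have h1 := hF.cylDensity_le hp (s := t₁) (σ := s - t₁) hTt₁ hσ hτ
  rw [show t₁ + (s - t₁) = s by ring] at h1
  have hτ' : 1 ≤ τ + (s - t₁) := by linarith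
  have h2 := cylDensity_le_one_add_tail_mul (A := Set.range (F t₁))
    (by rintro z ⟨x, rfl⟩; exact hF.mem_cyl t₁ hTt₁ x) hp hτ'
  have h3 : tail (τ + (s - t₁)) ≤ δ :=
    ((tail_le_tail (by linarith) (by linarith : σ₀ ≤ τ + (s - t₁))).trans hσ₀.le)
  have hsq : (1 + δ) * (1 + δ) ≤ 1 + ε := by nlinarith
  calc cylDensity (Set.range (F s)) p τ
      ≤ cylDensity (Set.range (F t₁)) p (τ + (s - t₁)) := h1
    _ ≤ ENNReal.ofReal (1 + tail (τ + (s - t₁))) *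
          ((μH[4] (Metric.sphere (0 : (EuclideanSpace ℝ (Fin 5))) 1))⁻¹ *
            μH[4] (Set.range (F t₁))) := h2
    _ ≤ ENNReal.ofReal (1 + δ) *
          ((μH[4] (Metric.sphere (0 : (EuclideanSpace ℝ (Fin 5))) 1))⁻¹ *
            (ENNReal.ofReal (1 + δ) * Ainf)) := by
        gcongr
    _ = ENNReal.ofReal ((1 + δ) * (1 + δ)) *
          ((μH[4] (Metric.sphere (0 : (EuclideanSpace ℝ (Fin 5))) 1))⁻¹ * Ainf) := by
        rw [ENNReal.ofReal_mul (by linarith)]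
        ring
    _ ≤ ENNReal.ofReal (1 + ε) *
          ((μH[4] (Metric.sphere (0 : (EuclideanSpace ℝ (Fin 5))) 1))⁻¹ * Ainf) := by
        gcongr

end Summit.SmoothPoincare4.SmoothPoincare4.Cruxes.CylinderRungTwo.KillingFlux

end
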